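import Literature.MathematicalPhysics.QuantumFieldTheory.Balaban1983to89.B9Eq3104CommutatorGradFormCurl
import Literature.MathematicalPhysics.QuantumFieldTheory.Balaban1983to89.B9Eq3104CommutatorSizesDD

/-!
# `Balaban1983to89.B9Eq3104CommutatorSizesCurl` — T. Bałaban, *Propagators for lattice gauge theories in a background field*,
# Commun. Math. Phys. **99** (1985) 389–434 [Balaban1985BackgroundPropagators], Sect. C p. 414 l. 1–3 («[D*D, h] … first order … O(M⁻¹), or O(M⁻²), if
# considered on a proper scale»): THE PRINT-SHAPE SIZE OF THE HESSIAN-CURL PIECE `[h_□, D*_U𝒦_UD_U]` OF `K(h_□)(U)` AT THE COVER OF RECORD, IN GRADIENT FORM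
# — for ANY «sandwich» `T = c_f Σ_μ ∇*_μ ∘ 𝒦_{μν} ∘ (∇_μ(·)_ν − ∇_ν(·)_μ)` with a bounded, almost-covariant pointwise insertion, and its instance: def-Y's
# `coCurlY U ∘ jordanY U ∘ curlY U` through this seat's component formulas (3.4)∕(3.9)∕(3.10) (module M5.7-est, file D′₂)

statement-level skeleton of published theorems with citation tags; proofs where landed; nothing here is a claim about the Yang–Mills mass gap

## WHAT THIS FILE PROVES (THEOREMS + one definition `jIns` with a body; 0 `def … : Prop`, 0 sorry)
* §1 `norm_ins_term_le` — ONE gradient-form summand of `B9Eq3104CommutatorGradFormCurl.cdsS_ins_cdS_cutMulY_apply_grad` at `h = h_□`, for an insertion family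
  with `‖𝒦_zZ‖ ≤ κ‖Z‖` and CONJUGATION DEFECT `‖R(U_μ(w))⁻¹𝒦_w(R(U_μ(w))Z) − 𝒦_xZ‖ ≤ δ_K‖Z‖` (displayed; zero at `U = 1` for a constant insertion), bi-contractive
  `U`, plaquette-holonomy defect `δ_P` (displayed):
  `‖∇*_μ(𝒦∇_λ(h_□Φ))(x) − h_□(x)∇*_μ(𝒦∇_λΦ)(x)‖ ≤ κθ₁‖∇_λΦ(x−e_μ)‖ + θ₁δ_K‖Φ(x−e_μ+e_λ)‖ + κθ₁(‖∇*_μΦ(x+e_λ)‖ + δ_P‖Φ(x−e_μ+e_λ)‖) + κθ₂‖Φ(x−e_μ+e_λ)‖`.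
* §2 ★★ `norm_cutCommR_sandwich_hTY_apply_le` — for any bond operator `T` with the displayed COMPONENT FORM
  `T A (⟨y,ν⟩) = c_f•Σ_μ (∇*_μ(z ↦ 𝒦_{μν,z}(∇_μA_ν(z)) − 𝒦_{μν,z}(∇_νA_μ(z)))(chart y) − ∇*_μ(z ↦ 𝒦_{νμ,z}(∇_νA_μ(z)) − 𝒦_{νμ,z}(∇_μA_ν(z)))(chart y))`
  and local bounds `G₀` (components within two steps of `chart y`), `G₁` (their `∇`∕`∇*` entries there):
  `‖([h_□]T)A(b)‖ ≤ |c_f|·(d+1)·4·(κ(2θ₁G₁ + (θ₁δ_P + θ₂)G₀) + θ₁δ_KG₀)`.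
* §3 THE INSTANCE: `jIns U a e z` (def-Y's Jordan insertion `Z ↦ c_f·½(Z·Re U(∂p) + Re U(∂p)·Z)` at `p = p_{ae}(chart⁻¹z)`, `0` unless `a < e`) and
  ★ `hessCurlY_apply_eq` — `(D*_U𝒦_UD_U A)(b)` HAS that component form with `𝒦 = jIns U` (from this seat's `coCurlY_apply_eq` (3.9), `extP_jordanY` (3.10),
  `extP_curlY` (3.4), `cdB_eq_cdS_bondCompY` (3.3)); `norm_jIns_le` (`κ = |c_f|·ρ` given `‖Re U(∂p)‖ ≤ ρ`).
HONEST SCOPE.  Sizes against LOCAL SUP DATA and DISPLAYED smallness constants (`δ_P`, `δ_K`, `ρ` — the class-(3.35) owner supplies them; at `U = 1`: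
`δ_P = 0`, `ρ = 1`, `δ_K = 0`); the `curv2Y` and averaging pieces are file D′₃, the (3.89)-twin is file E′; nothing of Thm 3.10 ∕ 3.3 asserted; YM mass
gap NOT proved by any of this (Track A conditional rung).  `--supports stmt-QuantumFields-19200`.  Net new unproved facts: 0.
-/

noncomputable section

namespace Literature.MathematicalPhysics.QuantumFieldTheory.Balaban1983to89.B9Eq3104CommutatorSizesCurl

open Node00
open B9Thm37CubeCoverCommutators (cutMulY cutMulY_apply hTY hTY_apply)
open B9Thm37CubeCoverCommutatorSizes (side_conditions abs_hTY_shiftY_sub_le abs_hTY_shiftY_symm_sub_le)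
open B9Eq3104CutoffCommutators (cutCommR cutCommR_apply hBdY hBdY_apply)
open B9Eq3104CommutatorGradFormDD (shiftY_symm_shiftY_comm shiftY_shiftY_symm shiftY_symm_shiftY bondCompY_cutMulY cdB_eq_cdS_bondCompY)
open B9Eq3104CommutatorGradFormCurl (cdsS_ins_cdS_cutMulY_apply_grad extP extP_chartY extP_curlY extP_jordanY coCurlY_apply_eq)
open B9Eq3104CommutatorSizesDD (abs_hTY_mixed_le)
open B6KLevelCensusIndexV1 (KIdx)
open B6GlobalChartV1 (PV)
open B6MultiLevelBoxOperator (bigSide)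
open B6Cover236MultiLevelBlocks (cubes)
open B6Partition118KLevelFineSizes (C1F C1F_nonneg)
open B6Partition118KLevelFineMixed (C2X C2X_bounds)
open Node00.OpsYNablaBridge (chartY bondCompY bondCompY_apply cdS_apply cdsS_apply)
open B9Eq39Adjoint (R R_smul R_sub R_zero plaqU)
open B9Eq310Hermitian (norm_R_le)
open scoped Matrix

variable {𝔸 : Type} [NormedRing 𝔸] [NormedAlgebra ℂ 𝔸] [CompleteSpace 𝔸]
variable {d ℓ : ℕ} {hd : 1 ≤ d + 1} {hL : Odd (ℓ + 1) ∧ 1 < ℓ + 1} {b₀ b₁ : ℝ}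
variable (i : KIdx d ℓ hd hL b₀ b₁)

/-! ## §1 One gradient-form summand with an insertion, sized -/

/-- **ONE SUMMAND OF `∇*_μ ∘ 𝒦 ∘ [h_□, ∇_λ]` IN GRADIENT FORM, SIZED** (`w = x − e_μ`; `θ₁ = C1F∕(8S_j∕5)`, `θ₂ = C2X∕(8S_j∕5)²`):
`‖∇*_μ(𝒦∇_λ(h_□Φ))(x) − h_□(x)•∇*_μ(𝒦∇_λΦ)(x)‖ ≤ κθ₁‖∇_λΦ(w)‖ + θ₁δ_K‖Φ(w+e_λ)‖ + κθ₁(‖∇*_μΦ(x+e_λ)‖ + δ_P‖Φ(w+e_λ)‖) + κθ₂‖Φ(w+e_λ)‖`.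
[cite: Balaban1985BackgroundPropagators, p.414 l.1–3, (3.100) p.413, (3.10) p.392, (3.7) p.391; Balaban1984PropagatorsII, p.247] -/
theorem norm_ins_term_le (c : ↥(cubes i.D.toDomains)) (U : CfgY 𝔸 i)
    (hU : ∀ μ x, ‖(U μ x : 𝔸)‖ ≤ 1 ∧ ‖(((U μ x)⁻¹ : 𝔸ˣ) : 𝔸)‖ ≤ 1) {δP : ℝ} (hδP : 0 ≤ δP)
    (hP : ∀ (μ lam : Fin (d + 1)) (w : SiteY i) (Y : 𝔸), ‖R (plaqU (shiftY i) (UboxY i U) μ lam w) Y - Y‖ ≤ δP * ‖Y‖)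
    (K : SiteY i → 𝔸 →ₗ[ℂ] 𝔸) {κ δK : ℝ} (hκ : 0 ≤ κ) (hδK : 0 ≤ δK) (hK : ∀ z Z, ‖K z Z‖ ≤ κ * ‖Z‖)
    (hKc : ∀ (μ : Fin (d + 1)) (x : SiteY i) (Z : 𝔸),
      ‖R (UboxY i U μ ((shiftY i μ).symm x))⁻¹ (K ((shiftY i μ).symm x) (R (UboxY i U μ ((shiftY i μ).symm x)) Z)) - K x Z‖ ≤ δK * ‖Z‖)
    (μ lam : Fin (d + 1)) (Φ : SiteY i → 𝔸) (x : SiteY i) :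
    ‖cdsS i U μ (fun z => K z (cdS i U lam (cutMulY (hTY i c) Φ) z)) x - ((hTY i c x : ℝ) : ℂ) • cdsS i U μ (fun z => K z (cdS i U lam Φ z)) x‖
      ≤ κ * (C1F d ℓ / (8 / 5 * (bigSide ℓ i.Mh c.1.1 : ℝ))) * ‖cdS i U lam Φ ((shiftY i μ).symm x)‖
        + C1F d ℓ / (8 / 5 * (bigSide ℓ i.Mh c.1.1 : ℝ)) * δK * ‖Φ (shiftY i lam ((shiftY i μ).symm x))‖
        + κ * (C1F d ℓ / (8 / 5 * (bigSide ℓ i.Mh c.1.1 : ℝ)))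
            * (‖cdsS i U μ Φ (shiftY i lam x)‖ + δP * ‖Φ (shiftY i lam ((shiftY i μ).symm x))‖)
        + κ * (C2X d ℓ / (8 / 5 * (bigSide ℓ i.Mh c.1.1 : ℝ)) ^ 2) * ‖Φ (shiftY i lam ((shiftY i μ).symm x))‖ := by
  have hUb : ∀ μ (w : SiteY i), ‖(UboxY i U μ w : 𝔸)‖ ≤ 1 ∧ ‖(((UboxY i U μ w)⁻¹ : 𝔸ˣ) : 𝔸)‖ ≤ 1 := fun μ w => hU μ _
  have hRle : ∀ μ (w : SiteY i) (X : 𝔸), ‖R (UboxY i U μ w) X‖ ≤ ‖X‖ := fun μ w X => norm_R_le (hUb μ w).1 (hUb μ w).2 X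
  have hRle' : ∀ μ (w : SiteY i) (X : 𝔸), ‖R (UboxY i U μ w)⁻¹ X‖ ≤ ‖X‖ :=
    fun μ w X => norm_R_le (hUb μ w).2 (by rw [inv_inv]; exact (hUb μ w).1) X
  have hθ₁ : 0 ≤ C1F d ℓ / (8 / 5 * (bigSide ℓ i.Mh c.1.1 : ℝ)) := div_nonneg (C1F_nonneg d ℓ) (by positivity)
  have hθ₂ : 0 ≤ C2X d ℓ / (8 / 5 * (bigSide ℓ i.Mh c.1.1 : ℝ)) ^ 2 := div_nonneg (C2X_bounds d ℓ).2.2 (by positivity)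
  rw [cdsS_ins_cdS_cutMulY_apply_grad, add_assoc, add_assoc, add_assoc, add_sub_cancel_left]
  -- sizes of `h`-coefficients
  have g1 : |hTY i c ((shiftY i μ).symm x) - hTY i c x| ≤ C1F d ℓ / (8 / 5 * (bigSide ℓ i.Mh c.1.1 : ℝ)) := abs_hTY_shiftY_symm_sub_le i c μ x
  have g2 : |hTY i c (shiftY i lam x) - hTY i c x| ≤ C1F d ℓ / (8 / 5 * (bigSide ℓ i.Mh c.1.1 : ℝ)) := abs_hTY_shiftY_sub_le i c lam x
  have g3 : |(hTY i c (shiftY i lam ((shiftY i μ).symm x)) - hTY i c ((shiftY i μ).symm x)) - (hTY i c (shiftY i lam x) - hTY i c x)|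
      ≤ C2X d ℓ / (8 / 5 * (bigSide ℓ i.Mh c.1.1 : ℝ)) ^ 2 := by
    have e := abs_hTY_mixed_le i c μ lam x
    have r : (hTY i c (shiftY i lam ((shiftY i μ).symm x)) - hTY i c ((shiftY i μ).symm x)) - (hTY i c (shiftY i lam x) - hTY i c x)
        = (hTY i c (shiftY i lam ((shiftY i μ).symm x)) - hTY i c (shiftY i lam x)) - (hTY i c ((shiftY i μ).symm x) - hTY i c x) := by ring
    rw [r]; exact e
  -- the value `Z = R(U_μ w)⁻¹R(U_λ w)Φ(w+e_λ)` and its size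
  have hZ : ‖R (UboxY i U μ ((shiftY i μ).symm x))⁻¹ (R (UboxY i U lam ((shiftY i μ).symm x)) (Φ (shiftY i lam ((shiftY i μ).symm x))))‖
      ≤ ‖Φ (shiftY i lam ((shiftY i μ).symm x))‖ := (hRle' μ _ _).trans (hRle lam _ _)
  -- the four terms
  have n1 : ‖((hTY i c ((shiftY i μ).symm x) - hTY i c x : ℝ) : ℂ) • R (UboxY i U μ ((shiftY i μ).symm x))⁻¹
        (K ((shiftY i μ).symm x) (cdS i U lam Φ ((shiftY i μ).symm x)))‖
      ≤ κ * (C1F d ℓ / (8 / 5 * (bigSide ℓ i.Mh c.1.1 : ℝ))) * ‖cdS i U lam Φ ((shiftY i μ).symm x)‖ := by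
    rw [norm_smul, Complex.norm_real, Real.norm_eq_abs]
    calc |hTY i c ((shiftY i μ).symm x) - hTY i c x| * ‖R (UboxY i U μ ((shiftY i μ).symm x))⁻¹ (K ((shiftY i μ).symm x) (cdS i U lam Φ ((shiftY i μ).symm x)))‖
        ≤ C1F d ℓ / (8 / 5 * (bigSide ℓ i.Mh c.1.1 : ℝ)) * (κ * ‖cdS i U lam Φ ((shiftY i μ).symm x)‖) :=
          mul_le_mul g1 ((hRle' μ _ _).trans (hK _ _)) (norm_nonneg _) hθ₁
      _ = _ := by ring
  have n2 : ‖((hTY i c (shiftY i lam x) - hTY i c x : ℝ) : ℂ) •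
        (R (UboxY i U μ ((shiftY i μ).symm x))⁻¹ (K ((shiftY i μ).symm x) (R (UboxY i U μ ((shiftY i μ).symm x))
            (R (UboxY i U μ ((shiftY i μ).symm x))⁻¹
              (R (UboxY i U lam ((shiftY i μ).symm x)) (Φ (shiftY i lam ((shiftY i μ).symm x)))))))
          - K x (R (UboxY i U μ ((shiftY i μ).symm x))⁻¹
              (R (UboxY i U lam ((shiftY i μ).symm x)) (Φ (shiftY i lam ((shiftY i μ).symm x))))))‖
      ≤ C1F d ℓ / (8 / 5 * (bigSide ℓ i.Mh c.1.1 : ℝ)) * δK * ‖Φ (shiftY i lam ((shiftY i μ).symm x))‖ := by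
    rw [norm_smul, Complex.norm_real, Real.norm_eq_abs, mul_assoc]
    exact mul_le_mul g2 ((hKc μ x _).trans (mul_le_mul_of_nonneg_left hZ hδK)) (norm_nonneg _) hθ₁
  have n3 : ‖((hTY i c (shiftY i lam x) - hTY i c x : ℝ) : ℂ) • K x
        (R (UboxY i U lam x) (cdsS i U μ Φ (shiftY i lam x))
          + R (UboxY i U μ ((shiftY i μ).symm x))⁻¹
              (R (UboxY i U lam ((shiftY i μ).symm x)) (Φ (shiftY i lam ((shiftY i μ).symm x)))
                - R (plaqU (shiftY i) (UboxY i U) μ lam ((shiftY i μ).symm x))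
                    (R (UboxY i U lam ((shiftY i μ).symm x)) (Φ (shiftY i lam ((shiftY i μ).symm x))))))‖
      ≤ κ * (C1F d ℓ / (8 / 5 * (bigSide ℓ i.Mh c.1.1 : ℝ)))
          * (‖cdsS i U μ Φ (shiftY i lam x)‖ + δP * ‖Φ (shiftY i lam ((shiftY i μ).symm x))‖) := by
    rw [norm_smul, Complex.norm_real, Real.norm_eq_abs]
    have hin : ‖R (UboxY i U lam x) (cdsS i U μ Φ (shiftY i lam x))
          + R (UboxY i U μ ((shiftY i μ).symm x))⁻¹
              (R (UboxY i U lam ((shiftY i μ).symm x)) (Φ (shiftY i lam ((shiftY i μ).symm x)))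
                - R (plaqU (shiftY i) (UboxY i U) μ lam ((shiftY i μ).symm x))
                    (R (UboxY i U lam ((shiftY i μ).symm x)) (Φ (shiftY i lam ((shiftY i μ).symm x)))))‖
        ≤ ‖cdsS i U μ Φ (shiftY i lam x)‖ + δP * ‖Φ (shiftY i lam ((shiftY i μ).symm x))‖ := by
      refine (norm_add_le _ _).trans (add_le_add (hRle lam _ _) ((hRle' μ _ _).trans ?_))
      rw [← norm_neg, neg_sub]
      exact (hP μ lam _ _).trans (mul_le_mul_of_nonneg_left (hRle lam _ _) hδP)
    calc |hTY i c (shiftY i lam x) - hTY i c x| * ‖K x (R (UboxY i U lam x) (cdsS i U μ Φ (shiftY i lam x))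
            + R (UboxY i U μ ((shiftY i μ).symm x))⁻¹
                (R (UboxY i U lam ((shiftY i μ).symm x)) (Φ (shiftY i lam ((shiftY i μ).symm x)))
                  - R (plaqU (shiftY i) (UboxY i U) μ lam ((shiftY i μ).symm x))
                      (R (UboxY i U lam ((shiftY i μ).symm x)) (Φ (shiftY i lam ((shiftY i μ).symm x))))))‖
        ≤ C1F d ℓ / (8 / 5 * (bigSide ℓ i.Mh c.1.1 : ℝ))
            * (κ * (‖cdsS i U μ Φ (shiftY i lam x)‖ + δP * ‖Φ (shiftY i lam ((shiftY i μ).symm x))‖)) :=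
          mul_le_mul g2 ((hK _ _).trans (mul_le_mul_of_nonneg_left hin hκ)) (norm_nonneg _) hθ₁
      _ = _ := by ring
  have n4 : ‖(((hTY i c (shiftY i lam ((shiftY i μ).symm x)) - hTY i c ((shiftY i μ).symm x)) - (hTY i c (shiftY i lam x) - hTY i c x) : ℝ) : ℂ)
        • R (UboxY i U μ ((shiftY i μ).symm x))⁻¹
            (K ((shiftY i μ).symm x) (R (UboxY i U lam ((shiftY i μ).symm x)) (Φ (shiftY i lam ((shiftY i μ).symm x)))))‖
      ≤ κ * (C2X d ℓ / (8 / 5 * (bigSide ℓ i.Mh c.1.1 : ℝ)) ^ 2) * ‖Φ (shiftY i lam ((shiftY i μ).symm x))‖ := by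
    rw [norm_smul, Complex.norm_real, Real.norm_eq_abs]
    calc |(hTY i c (shiftY i lam ((shiftY i μ).symm x)) - hTY i c ((shiftY i μ).symm x)) - (hTY i c (shiftY i lam x) - hTY i c x)|
          * ‖R (UboxY i U μ ((shiftY i μ).symm x))⁻¹
              (K ((shiftY i μ).symm x) (R (UboxY i U lam ((shiftY i μ).symm x)) (Φ (shiftY i lam ((shiftY i μ).symm x)))))‖
        ≤ C2X d ℓ / (8 / 5 * (bigSide ℓ i.Mh c.1.1 : ℝ)) ^ 2 * (κ * ‖Φ (shiftY i lam ((shiftY i μ).symm x))‖) :=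
          mul_le_mul g3 ((hRle' μ _ _).trans ((hK _ _).trans (mul_le_mul_of_nonneg_left (hRle lam _ _) hκ))) (norm_nonneg _) hθ₂
      _ = _ := by ring
  have s := (norm_add_le _ _).trans (add_le_add n1 ((norm_add_le _ _).trans (add_le_add n2 ((norm_add_le _ _).trans (add_le_add n3 n4)))))
  linarith [s]

/-! ## §2 The cut-off commutator of a «sandwich» operator with the displayed component form -/

/-- ★★ **THE HESSIAN-CURL-TYPE PIECE OF `K(h_□)(U)` IN PRINT'S SHAPE — p. 414 l. 1–3.**  For a bond operator `T` with the COMPONENT FORM of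
`D*_U ∘ 𝒦 ∘ D_U` (hypothesis `hT`; for def-Y's letters it is `hessCurlY_apply_eq` below), an insertion family `𝒦_{ae,z}` with `‖𝒦Z‖ ≤ κ‖Z‖` and
conjugation defect `δ_K`, bi-contractive `U`, plaquette-holonomy defect `δ_P`, the cut-off `h_□` of the cover of record, and local bounds at `b = ⟨y,ν⟩`,
`x = chart y`: `G₀ ≥ ‖A_a(σ_λσ_μ⁻¹x)‖` and `G₁ ≥ ‖(∇_λA_a)(σ_μ⁻¹x)‖, ‖(∇*_μA_a)(σ_λx)‖` (all `a, λ, μ`):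
`‖([h_□]T)A(b)‖ ≤ |c_f|·(d+1)·4·(κ(2θ₁G₁ + (θ₁δ_P + θ₂)G₀) + θ₁δ_KG₀)`, `θ₁ = C1F∕(8S_j∕5)`, `θ₂ = C2X∕(8S_j∕5)²`.
[cite: Balaban1985BackgroundPropagators, p.414 l.1–3, (3.100) p.413, (3.4) p.391, (3.9)–(3.10) p.392, (3.89) p.409; Balaban1984PropagatorsII, p.247] -/
theorem norm_cutCommR_sandwich_hTY_apply_le (c : ↥(cubes i.D.toDomains)) (U : CfgY 𝔸 i)
    (hU : ∀ μ x, ‖(U μ x : 𝔸)‖ ≤ 1 ∧ ‖(((U μ x)⁻¹ : 𝔸ˣ) : 𝔸)‖ ≤ 1) {δP : ℝ} (hδP : 0 ≤ δP)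
    (hP : ∀ (μ lam : Fin (d + 1)) (w : SiteY i) (Y : 𝔸), ‖R (plaqU (shiftY i) (UboxY i U) μ lam w) Y - Y‖ ≤ δP * ‖Y‖)
    (Kf : Fin (d + 1) → Fin (d + 1) → SiteY i → 𝔸 →ₗ[ℂ] 𝔸) {κ δK : ℝ} (hκ : 0 ≤ κ) (hδK : 0 ≤ δK)
    (hK : ∀ a e z Z, ‖Kf a e z Z‖ ≤ κ * ‖Z‖)
    (hKc : ∀ a e (μ : Fin (d + 1)) (x : SiteY i) (Z : 𝔸),
      ‖R (UboxY i U μ ((shiftY i μ).symm x))⁻¹ (Kf a e ((shiftY i μ).symm x) (R (UboxY i U μ ((shiftY i μ).symm x)) Z)) - Kf a e x Z‖ ≤ δK * ‖Z‖)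
    (T : (FBondY i → 𝔸) →ₗ[ℂ] (FBondY i → 𝔸))
    (hT : ∀ (A : FBondY i → 𝔸) (b : FBondY i), T A b = ((i.cf : ℝ) : ℂ) • ∑ μ : Fin (d + 1),
      (cdsS i U μ (fun z => Kf μ b.dir z (cdS i U μ (bondCompY i b.dir A) z) - Kf μ b.dir z (cdS i U b.dir (bondCompY i μ A) z)) (chartY i b.src)
        - cdsS i U μ (fun z => Kf b.dir μ z (cdS i U b.dir (bondCompY i μ A) z) - Kf b.dir μ z (cdS i U μ (bondCompY i b.dir A) z))
            (chartY i b.src)))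
    (A : FBondY i → 𝔸) (b : FBondY i) {G₀ G₁ : ℝ}
    (hA₀ : ∀ a lam μ : Fin (d + 1), ‖bondCompY i a A (shiftY i lam ((shiftY i μ).symm (chartY i b.src)))‖ ≤ G₀)
    (hA₁ : ∀ a lam μ : Fin (d + 1), ‖cdS i U lam (bondCompY i a A) ((shiftY i μ).symm (chartY i b.src))‖ ≤ G₁
      ∧ ‖cdsS i U μ (bondCompY i a A) (shiftY i lam (chartY i b.src))‖ ≤ G₁) :
    ‖cutCommR (hBdY i (hTY i c)) (hBdY i (hTY i c)) T A b‖
      ≤ |i.cf| * (((d : ℝ) + 1) * (4 * (κ * (2 * (C1F d ℓ / (8 / 5 * (bigSide ℓ i.Mh c.1.1 : ℝ))) * G₁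
          + (C1F d ℓ / (8 / 5 * (bigSide ℓ i.Mh c.1.1 : ℝ)) * δP + C2X d ℓ / (8 / 5 * (bigSide ℓ i.Mh c.1.1 : ℝ)) ^ 2) * G₀)
          + C1F d ℓ / (8 / 5 * (bigSide ℓ i.Mh c.1.1 : ℝ)) * δK * G₀))) := by
  have hθ₁ : 0 ≤ C1F d ℓ / (8 / 5 * (bigSide ℓ i.Mh c.1.1 : ℝ)) := div_nonneg (C1F_nonneg d ℓ) (by positivity)
  have hθ₂ : 0 ≤ C2X d ℓ / (8 / 5 * (bigSide ℓ i.Mh c.1.1 : ℝ)) ^ 2 := div_nonneg (C2X_bounds d ℓ).2.2 (by positivity)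
  -- abbreviations
  set θ₁ := C1F d ℓ / (8 / 5 * (bigSide ℓ i.Mh c.1.1 : ℝ)) with hθ₁def
  set θ₂ := C2X d ℓ / (8 / 5 * (bigSide ℓ i.Mh c.1.1 : ℝ)) ^ 2 with hθ₂def
  set x := chartY i b.src with hxdef
  set h := hTY i c with hhdef
  -- one instance of §1, read against the local bounds
  have inst : ∀ (a e μ lam a' : Fin (d + 1)),
      ‖cdsS i U μ (fun z => Kf a e z (cdS i U lam (cutMulY h (bondCompY i a' A)) z)) x
          - ((h x : ℝ) : ℂ) • cdsS i U μ (fun z => Kf a e z (cdS i U lam (bondCompY i a' A) z)) x‖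
        ≤ κ * (2 * θ₁ * G₁ + (θ₁ * δP + θ₂) * G₀) + θ₁ * δK * G₀ := by
    intro a e μ lam a'
    refine (norm_ins_term_le i c U hU hδP hP (Kf a e) hκ hδK (hK a e) (hKc a e) μ lam (bondCompY i a' A) x).trans ?_
    have e1 := (hA₁ a' lam μ).1
    have e2 := (hA₁ a' lam μ).2
    have e3 := hA₀ a' lam μ
    have t1 : κ * θ₁ * ‖cdS i U lam (bondCompY i a' A) ((shiftY i μ).symm x)‖ ≤ κ * θ₁ * G₁ := mul_le_mul_of_nonneg_left e1 (mul_nonneg hκ hθ₁)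
    have t2 : θ₁ * δK * ‖bondCompY i a' A (shiftY i lam ((shiftY i μ).symm x))‖ ≤ θ₁ * δK * G₀ := mul_le_mul_of_nonneg_left e3 (mul_nonneg hθ₁ hδK)
    have t3 : κ * θ₁ * (‖cdsS i U μ (bondCompY i a' A) (shiftY i lam x)‖ + δP * ‖bondCompY i a' A (shiftY i lam ((shiftY i μ).symm x))‖)
        ≤ κ * θ₁ * (G₁ + δP * G₀) := mul_le_mul_of_nonneg_left (add_le_add e2 (mul_le_mul_of_nonneg_left e3 hδP)) (mul_nonneg hκ hθ₁)
    have t4 : κ * θ₂ * ‖bondCompY i a' A (shiftY i lam ((shiftY i μ).symm x))‖ ≤ κ * θ₂ * G₀ := mul_le_mul_of_nonneg_left e3 (mul_nonneg hκ hθ₂)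
    have := add_le_add (add_le_add (add_le_add t1 t2) t3) t4
    refine this.trans (le_of_eq ?_)
    ring
  -- the commutator through the component form
  have hcomp : ∀ a : Fin (d + 1), bondCompY i a (cutMulY (hBdY i h) A) = cutMulY h (bondCompY i a A) := fun a => bondCompY_cutMulY i h a A
  rw [cutCommR_apply, hT, hT, hBdY_apply]
  simp only [hcomp]
  rw [← hxdef, smul_comm (((h x : ℝ)) : ℂ), ← smul_sub, norm_smul, Complex.norm_real, Real.norm_eq_abs, Finset.smul_sum, ← Finset.sum_sub_distrib]
  refine mul_le_mul_of_nonneg_left ?_ (abs_nonneg _)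
  -- per `μ`: four instances
  have per : ∀ μ : Fin (d + 1),
      ‖((h x : ℝ) : ℂ) • (cdsS i U μ (fun z => Kf μ b.dir z (cdS i U μ (bondCompY i b.dir A) z) - Kf μ b.dir z (cdS i U b.dir (bondCompY i μ A) z)) x
            - cdsS i U μ (fun z => Kf b.dir μ z (cdS i U b.dir (bondCompY i μ A) z) - Kf b.dir μ z (cdS i U μ (bondCompY i b.dir A) z)) x)
        - (cdsS i U μ (fun z => Kf μ b.dir z (cdS i U μ (cutMulY h (bondCompY i b.dir A)) z)
              - Kf μ b.dir z (cdS i U b.dir (cutMulY h (bondCompY i μ A)) z)) x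
            - cdsS i U μ (fun z => Kf b.dir μ z (cdS i U b.dir (cutMulY h (bondCompY i μ A)) z)
              - Kf b.dir μ z (cdS i U μ (cutMulY h (bondCompY i b.dir A)) z)) x)‖
        ≤ 4 * (κ * (2 * θ₁ * G₁ + (θ₁ * δP + θ₂) * G₀) + θ₁ * δK * G₀) := by
    intro μ
    -- `cdsS` of a pointwise difference is the difference
    have split : ∀ (F G : SiteY i → 𝔸), cdsS i U μ (fun z => F z - G z) x = cdsS i U μ F x - cdsS i U μ G x := by
      intro F G; simp only [cdsS_apply, R_sub]; abel
    rw [split, split, split, split]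
    have i1 := inst μ b.dir μ μ b.dir
    have i2 := inst μ b.dir μ b.dir μ
    have i3 := inst b.dir μ μ b.dir μ
    have i4 := inst b.dir μ μ μ b.dir
    -- regroup into the four commutator terms
    have e : ((h x : ℝ) : ℂ) • (cdsS i U μ (fun z => Kf μ b.dir z (cdS i U μ (bondCompY i b.dir A) z)) x
              - cdsS i U μ (fun z => Kf μ b.dir z (cdS i U b.dir (bondCompY i μ A) z)) x
              - (cdsS i U μ (fun z => Kf b.dir μ z (cdS i U b.dir (bondCompY i μ A) z)) x
                  - cdsS i U μ (fun z => Kf b.dir μ z (cdS i U μ (bondCompY i b.dir A) z)) x))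
          - (cdsS i U μ (fun z => Kf μ b.dir z (cdS i U μ (cutMulY h (bondCompY i b.dir A)) z)) x
              - cdsS i U μ (fun z => Kf μ b.dir z (cdS i U b.dir (cutMulY h (bondCompY i μ A)) z)) x
              - (cdsS i U μ (fun z => Kf b.dir μ z (cdS i U b.dir (cutMulY h (bondCompY i μ A)) z)) x
                  - cdsS i U μ (fun z => Kf b.dir μ z (cdS i U μ (cutMulY h (bondCompY i b.dir A)) z)) x))
        = -(cdsS i U μ (fun z => Kf μ b.dir z (cdS i U μ (cutMulY h (bondCompY i b.dir A)) z)) x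
              - ((h x : ℝ) : ℂ) • cdsS i U μ (fun z => Kf μ b.dir z (cdS i U μ (bondCompY i b.dir A) z)) x)
          + (cdsS i U μ (fun z => Kf μ b.dir z (cdS i U b.dir (cutMulY h (bondCompY i μ A)) z)) x
              - ((h x : ℝ) : ℂ) • cdsS i U μ (fun z => Kf μ b.dir z (cdS i U b.dir (bondCompY i μ A) z)) x)
          + (cdsS i U μ (fun z => Kf b.dir μ z (cdS i U b.dir (cutMulY h (bondCompY i μ A)) z)) x
              - ((h x : ℝ) : ℂ) • cdsS i U μ (fun z => Kf b.dir μ z (cdS i U b.dir (bondCompY i μ A) z)) x)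
          - (cdsS i U μ (fun z => Kf b.dir μ z (cdS i U μ (cutMulY h (bondCompY i b.dir A)) z)) x
              - ((h x : ℝ) : ℂ) • cdsS i U μ (fun z => Kf b.dir μ z (cdS i U μ (bondCompY i b.dir A) z)) x) := by
      simp only [smul_sub]; abel
    rw [e]
    have s := (norm_sub_le _ _).trans (add_le_add ((norm_add_le _ _).trans (add_le_add ((norm_add_le _ _).trans
      (add_le_add (le_of_eq (norm_neg _) |>.trans i1) i2)) i3)) i4)
    linarith [s]
  calc ‖∑ μ : Fin (d + 1), (((h x : ℝ) : ℂ) • (cdsS i U μ (fun z => Kf μ b.dir z (cdS i U μ (bondCompY i b.dir A) z)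
              - Kf μ b.dir z (cdS i U b.dir (bondCompY i μ A) z)) x
            - cdsS i U μ (fun z => Kf b.dir μ z (cdS i U b.dir (bondCompY i μ A) z) - Kf b.dir μ z (cdS i U μ (bondCompY i b.dir A) z)) x)
        - (cdsS i U μ (fun z => Kf μ b.dir z (cdS i U μ (cutMulY h (bondCompY i b.dir A)) z)
              - Kf μ b.dir z (cdS i U b.dir (cutMulY h (bondCompY i μ A)) z)) x
            - cdsS i U μ (fun z => Kf b.dir μ z (cdS i U b.dir (cutMulY h (bondCompY i μ A)) z)
              - Kf b.dir μ z (cdS i U μ (cutMulY h (bondCompY i b.dir A)) z)) x))‖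
      ≤ ∑ μ : Fin (d + 1), 4 * (κ * (2 * θ₁ * G₁ + (θ₁ * δP + θ₂) * G₀) + θ₁ * δK * G₀) :=
        (norm_sum_le _ _).trans (Finset.sum_le_sum fun μ _ => per μ)
    _ = _ := by rw [Finset.sum_const, Finset.card_univ, Fintype.card_fin, nsmul_eq_mul]; push_cast; ring

/-! ## §3 The instance: def-Y's `D*_U ∘ 𝒦_U ∘ D_U` -/

/-- def-Y's Jordan insertion, with the `c_f` of the curl absorbed, as a site-indexed family per ordered pair: `Z ↦ c_f·½(Z·Re U(∂p) + Re U(∂p)·Z)`,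
`p = p_{ae}(chart⁻¹z)` (`0` unless `a < e`). [cite: Balaban1985BackgroundPropagators, (3.10) p.392, (3.7) p.391, dictionary] -/
def jIns (U : CfgY 𝔸 i) (a e : Fin (d + 1)) (z : SiteY i) : 𝔸 →ₗ[ℂ] 𝔸 :=
  if hae : a < e then
    ((i.cf : ℝ) : ℂ) • ((1 / 2 : ℂ) • (LinearMap.mulRight ℂ (reHolY i U ⟨(chartY i).symm z, a, e, hae⟩)
      + LinearMap.mulLeft ℂ (reHolY i U ⟨(chartY i).symm z, a, e, hae⟩)))
  else 0

/-- the size of the insertion: `‖Re U(∂p)‖ ≤ ρ ⇒ ‖jIns Z‖ ≤ |c_f|ρ‖Z‖`. [cite: Balaban1985BackgroundPropagators, (3.10) p.392, (3.35) p.396] -/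
theorem norm_jIns_le (U : CfgY 𝔸 i) {ρ : ℝ} (hρ : 0 ≤ ρ) (hRe : ∀ p, ‖reHolY i U p‖ ≤ ρ) (a e : Fin (d + 1)) (z : SiteY i) (Z : 𝔸) :
    ‖jIns i U a e z Z‖ ≤ |i.cf| * ρ * ‖Z‖ := by
  unfold jIns
  split_ifs with hae
  · rw [LinearMap.smul_apply, LinearMap.smul_apply, norm_smul, Complex.norm_real, Real.norm_eq_abs, mul_assoc]
    refine mul_le_mul_of_nonneg_left ?_ (abs_nonneg _)
    rw [LinearMap.add_apply, LinearMap.mulRight_apply, LinearMap.mulLeft_apply, norm_smul]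
    have h1 := norm_mul_le Z (reHolY i U ⟨(chartY i).symm z, a, e, hae⟩)
    have h2 := norm_mul_le (reHolY i U ⟨(chartY i).symm z, a, e, hae⟩) Z
    have h3 := hRe ⟨(chartY i).symm z, a, e, hae⟩
    have hn : ‖(1 / 2 : ℂ)‖ = 1 / 2 := by norm_num
    rw [hn]
    nlinarith [norm_add_le (Z * reHolY i U ⟨(chartY i).symm z, a, e, hae⟩) (reHolY i U ⟨(chartY i).symm z, a, e, hae⟩ * Z), norm_nonneg Z]
  · rw [LinearMap.zero_apply, norm_zero]; positivity

/-- ★ **def-Y's `D*_U𝒦_UD_U` HAS THE COMPONENT FORM** of §2 with `𝒦 = jIns U`: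
`(coCurlY U ∘ jordanY U ∘ curlY U) A (⟨y,ν⟩) = c_f•Σ_μ (∇*_μ(z ↦ 𝒦_{μν,z}(∇_μA_ν(z)) − 𝒦_{μν,z}(∇_νA_μ(z)))(chart y) − (νμ-term))`.
[cite: Balaban1985BackgroundPropagators, (3.4) p.391, (3.9)–(3.10) p.392, (3.3) p.390] -/
theorem hessCurlY_apply_eq (U : CfgY 𝔸 i) (A : FBondY i → 𝔸) (b : FBondY i) :
    (coCurlY i U ∘ₗ jordanY i U ∘ₗ curlY i U) A b = ((i.cf : ℝ) : ℂ) • ∑ μ : Fin (d + 1),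
      (cdsS i U μ (fun z => jIns i U μ b.dir z (cdS i U μ (bondCompY i b.dir A) z) - jIns i U μ b.dir z (cdS i U b.dir (bondCompY i μ A) z))
          (chartY i b.src)
        - cdsS i U μ (fun z => jIns i U b.dir μ z (cdS i U b.dir (bondCompY i μ A) z) - jIns i U b.dir μ z (cdS i U μ (bondCompY i b.dir A) z))
            (chartY i b.src)) := by
  rw [LinearMap.comp_apply, LinearMap.comp_apply, coCurlY_apply_eq]
  -- the components of `𝒦_U D_U A` as site functions
  have key : ∀ a e : Fin (d + 1), extP i (jordanY i U (curlY i U A)) a e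
      = fun z => jIns i U a e z (cdS i U a (bondCompY i e A) z) - jIns i U a e z (cdS i U e (bondCompY i a A) z) := by
    intro a e
    funext z
    have hz : z = chartY i ((chartY i).symm z) := ((chartY i).apply_symm_apply z).symm
    rw [extP_jordanY]
    conv_lhs => rw [hz, extP_curlY, cdB_eq_cdS_bondCompY, cdB_eq_cdS_bondCompY]
    simp only [jIns]
    split_ifs with hae
    · rw [← hz]
      simp only [LinearMap.smul_apply, LinearMap.add_apply, LinearMap.mulRight_apply, LinearMap.mulLeft_apply, mul_sub, sub_mul,
        smul_mul_assoc, mul_smul_comm, smul_sub, smul_add]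
      module
    · simp
  simp only [key]

end Literature.MathematicalPhysics.QuantumFieldTheory.Balaban1983to89.B9Eq3104CommutatorSizesCurl

end
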